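import Mathlib.Tactic.Linarith
import Summits.CriticalPhenomena.PercolationContinuityZ3.Theorems.PercNearOneGluingNoHeavyLowerTailSahiCTCForms
import HarnessLib

/-!
# `NoHeavyLowerTail` (crux stmt-CriticalPhenomena-4575), P3 lane: the c = 1 certificate polynomial `Ñ₁` FACTORISES on all-live pairs
# (memo g9 §10: `Ñ₁ = e₁(1+e₁)(D−t_X)(D−t_Z)`), hence is coefficientwise ≥ 0 there — kernel-checked with the generating-function calculus

Support file (seat `prim-l12-p3`, gen 18; `--supports stmt-CriticalPhenomena-4575`).  Memo `run/shared/lean/prim/prim-l12/FROM-prim-l12-p3-g9-COEFFICIENTWISE-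
THRESHOLD-CERTIFICATE.md` §1 (form (A) of `Ñ_c`) and §10 (the all-live factorisation for c = 1).  For c = 1 the size classes are `Θ^{(1)}` = sets of size
`≤ 1` (= `Th1`), `D^{(1)}` = sets of size `≥ 2`, `h_K` = faces of size `≤ 1`, `t_K` = faces of size `≥ 2`, `h_Y` = common faces of size `≤ 1`, `e_Y` =
common vertices.  `N1gen K_X K_Z := e₁(Π+D^{(1)})(Π·h_Y − h_X·h_Z) − Θ^{(1)}·Π·D^{(1)}·e_Y − e₁·D^{(1)}·(h_X·t_Z + t_X·h_Z) + e₁·Θ^{(1)}·t_X·t_Z`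
(g9 form (A), c = 1; at the odds vector its sign is the (TC) row of the all-but-one certificate — that identification is not formalised here).
* `N1gen_eq_of_allLive` : if both complexes contain every set of size ≤ 1 then `N1gen = e₁·Θ₁·t̄⁽¹⁾_X·t̄⁽¹⁾_Z` with `t̄⁽¹⁾_K = GF(non-faces of size ≥ 2)
  = GF(ε̄_K) + GF(t̄_K)`;
* `coeff_N1gen_nonneg_of_allLive` : hence every coefficient of `N1gen` is `≥ 0` for all-live pairs (the c = 1 analogue of the open c = 2 statement; the
  all-but-one slot itself is already a tree theorem by a different route, `…SahiAllButOne`).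
Nothing is asserted about the crux.
-/

namespace Summit.CriticalPhenomena.PercolationContinuityZ3.Theorems.SahiCTCForms

open Finset MvPolynomial SahiCTCGenFun

variable {α : Type*} [DecidableEq α] [Fintype α]

/-- Faces of size `≤ 1` of a complex (`h_K` for c = 1). [this work] -/
def faces1 (K : Finset (Finset α)) : Finset (Finset α) := univ.powerset.filter fun S => #S ≤ 1 ∧ S ∈ K
/-- Faces of size `≥ 2` of a complex (`t_K` for c = 1). [this work] -/
def faces2up (K : Finset (Finset α)) : Finset (Finset α) := univ.powerset.filter fun S => 2 ≤ #S ∧ S ∈ K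
/-- Common faces of size `≤ 1` (`h_Y` for c = 1). [this work] -/
def commonFaces1 (KX KZ : Finset (Finset α)) : Finset (Finset α) := univ.powerset.filter fun S => #S ≤ 1 ∧ S ∈ KX ∧ S ∈ KZ
/-- Common vertices (`e_Y` for c = 1: common faces of size exactly 1). [this work] -/
def commonVerts (KX KZ : Finset (Finset α)) : Finset (Finset α) := univ.powerset.filter fun S => #S = 1 ∧ S ∈ KX ∧ S ∈ KZ
/-- Non-faces of size `≥ 2` (`t̄⁽¹⁾_K = ε̄_K ⊔ t̄_K`). [this work] -/
def nonFaces2up (K : Finset (Finset α)) : Finset (Finset α) := univ.powerset.filter fun S => 2 ≤ #S ∧ S ∉ K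

/-- `D^{(1)} = GF(sets of size ≥ 2)`. [this work] -/
noncomputable def D1 : MvPolynomial α ℤ := gf (bySize (2 ≤ ·) : Finset (Finset α))

/-- **The generic c = 1 certificate polynomial `Ñ₁(K_X,K_Z)`** (g9 form (A) with c = 1). [this work] -/
noncomputable def N1gen (KX KZ : Finset (Finset α)) : MvPolynomial α ℤ :=
  ee 1 * (PiP + D1) * (PiP * gf (commonFaces1 KX KZ) - gf (faces1 KX) * gf (faces1 KZ))
    - Th1 * PiP * D1 * gf (commonVerts KX KZ)
    - ee 1 * D1 * (gf (faces1 KX) * gf (faces2up KZ) + gf (faces2up KX) * gf (faces1 KZ))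
    + ee 1 * Th1 * gf (faces2up KX) * gf (faces2up KZ)

/-- All-live dictionary, c = 1: `h_K = Θ₁`, `D^{(1)} = t_K + t̄⁽¹⁾_K`. [this work] -/
theorem allLive_c1 {K : Finset (Finset α)} (hK1 : ∀ S : Finset α, #S ≤ 1 → S ∈ K) :
    gf (faces1 K) = (Th1 : MvPolynomial α ℤ) ∧ (D1 : MvPolynomial α ℤ) = gf (faces2up K) + gf (nonFaces2up K) := by
  constructor
  · have : faces1 K = (bySize (· ≤ 1) : Finset (Finset α)) := by
      ext S; simp only [faces1, bySize, mem_filter]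
      exact ⟨fun h => ⟨h.1, h.2.1⟩, fun h => ⟨h.1, h.2, hK1 S h.2⟩⟩
    unfold Th1; rw [this]
  · have hU : (bySize (2 ≤ ·) : Finset (Finset α)) = faces2up K ∪ nonFaces2up K := by
      ext S; simp only [bySize, faces2up, nonFaces2up, mem_filter, mem_union]; tauto
    have hD : Disjoint (faces2up K) (nonFaces2up K) := by
      rw [disjoint_left]; intro S h1 h2; simp only [faces2up, nonFaces2up, mem_filter] at h1 h2; tauto
    unfold D1; rw [hU, gf_union hD]

/-- All-live dictionary, c = 1, common parts: `h_Y = Θ₁`, `e_Y = e₁`. [this work] -/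
theorem allLive_c1_common {KX KZ : Finset (Finset α)} (hX1 : ∀ S : Finset α, #S ≤ 1 → S ∈ KX) (hZ1 : ∀ S : Finset α, #S ≤ 1 → S ∈ KZ) :
    gf (commonFaces1 KX KZ) = (Th1 : MvPolynomial α ℤ) ∧ gf (commonVerts KX KZ) = (ee 1 : MvPolynomial α ℤ) := by
  constructor
  · have : commonFaces1 KX KZ = (bySize (· ≤ 1) : Finset (Finset α)) := by
      ext S; simp only [commonFaces1, bySize, mem_filter]
      exact ⟨fun h => ⟨h.1, h.2.1⟩, fun h => ⟨h.1, h.2, hX1 S h.2, hZ1 S h.2⟩⟩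
    unfold Th1; rw [this]
  · have : commonVerts KX KZ = (bySize (· = 1) : Finset (Finset α)) := by
      ext S; simp only [commonVerts, bySize, mem_filter]
      exact ⟨fun h => ⟨h.1, h.2.1⟩, fun h => ⟨h.1, h.2, hX1 S (by rw [h.2]), hZ1 S (by rw [h.2])⟩⟩
    unfold ee; rw [this]

/-- `Π = Θ₁ + D^{(1)}`. [this work] -/
theorem PiP_eq_Th1_D1 : (PiP : MvPolynomial α ℤ) = Th1 + D1 := by
  have hU : (univ.powerset : Finset (Finset α)) = bySize (· ≤ 1) ∪ bySize (2 ≤ ·) := by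
    ext S; simp only [bySize, mem_filter, mem_union, mem_powerset]
    constructor
    · intro hS; rcases Nat.lt_or_ge #S 2 with h | h
      · exact Or.inl ⟨hS, by omega⟩
      · exact Or.inr ⟨hS, h⟩
    · rintro (⟨hS, _⟩ | ⟨hS, _⟩) <;> exact hS
  have hD : Disjoint (bySize (· ≤ 1) : Finset (Finset α)) (bySize (2 ≤ ·)) := by
    rw [disjoint_left]; intro S h1 h2; simp only [bySize, mem_filter] at h1 h2; omega
  unfold PiP Th1 D1; rw [hU, gf_union hD]

/-- **`Ñ₁ = e₁·Θ₁·t̄⁽¹⁾_X·t̄⁽¹⁾_Z` on all-live pairs** (memo g9 §10). [this work] -/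
theorem N1gen_eq_of_allLive {KX KZ : Finset (Finset α)} (hX1 : ∀ S : Finset α, #S ≤ 1 → S ∈ KX) (hZ1 : ∀ S : Finset α, #S ≤ 1 → S ∈ KZ) :
    N1gen KX KZ = ee 1 * Th1 * gf (nonFaces2up KX) * gf (nonFaces2up KZ) := by
  obtain ⟨hX, hDX⟩ := allLive_c1 hX1
  obtain ⟨hZ, hDZ⟩ := allLive_c1 hZ1
  obtain ⟨hY, hV⟩ := allLive_c1_common hX1 hZ1
  have hPi := PiP_eq_Th1_D1 (α := α)
  have htX : gf (faces2up KX) = (D1 : MvPolynomial α ℤ) - gf (nonFaces2up KX) := by rw [hDX]; ring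
  have htZ : gf (faces2up KZ) = (D1 : MvPolynomial α ℤ) - gf (nonFaces2up KZ) := by rw [hDZ]; ring
  unfold N1gen
  rw [hX, hZ, hY, hV, htX, htZ, hPi]
  ring

/-- **The c = 1 certificate polynomial is coefficientwise nonnegative on all-live pairs** (a product of generating functions). [this work] -/
theorem coeff_N1gen_nonneg_of_allLive {KX KZ : Finset (Finset α)} (hX1 : ∀ S : Finset α, #S ≤ 1 → S ∈ KX) (hZ1 : ∀ S : Finset α, #S ≤ 1 → S ∈ KZ)
    (n : α →₀ ℕ) : 0 ≤ (N1gen KX KZ).coeff n := by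
  rw [N1gen_eq_of_allLive hX1 hZ1]
  unfold ee Th1
  exact coeff_mul_nonneg (coeff_mul_nonneg (coeff_mul_nonneg (coeff_gf_nonneg _) (coeff_gf_nonneg _)) (coeff_gf_nonneg _)) (coeff_gf_nonneg _) n

end Summit.CriticalPhenomena.PercolationContinuityZ3.Theorems.SahiCTCForms
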